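import Summits.MatrixMultiplication.MatrixMultiplication.Theses.ReesMunnRealization

/-!
# Route `ReesMunnRealization` — the assembly item (stmt-MatrixMultiplication-4378)

Item `stmt-MatrixMultiplication-4378` (`Assembly`, rank 1) of route
`route-MatrixMultiplication-ReesMunnRealization` is the implication

  `BlockRestrictionBound → BlockRestrictionFamily → MatrixMultiplication`,

i.e. the Cohn–Umans block inequality in restriction form (`⟨a,b,e⟩ ≤ ⊕ᵢ ⟨dᵢ,dᵢ,dᵢ⟩ ⟹
(abe)^{ω/3} ≤ Σᵢ dᵢ^ω`) together with a constant-loss block-restriction family with arbitrarily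
many comparable blocks (`c·(Σ dᵢ²)^{3/2} ≤ abe`, `t·dᵢ² ≤ Σⱼ dⱼ²` for every `t`) decide `ω(ℂ) = 2`.
It is, verbatim, the type of the route's kernel-checked deciding theorem
`Summit.MatrixMultiplication.MatrixMultiplication.Theses.ReesMunnRealization.closes`; the proof
below is self-contained (it replays the same elementary real analysis and does not invoke `closes`).

Proof. `2 ≤ ω(ℂ)` is the flattening bound `omega_two_le`. Suppose `2 < w := ω(ℂ)` and put
`η := (w − 2)/2 > 0`. Since `t^{−η} → 0`, pick `t ≥ 1` with `t^{−η} < c^{w/3}`. The family at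
parameter `t` gives blocks `dᵢ ≥ 1` (`p ≥ 1` of them), `D := Σ dᵢ² > 0`, with
`c·D^{3/2} ≤ abe`, the restriction `⟨a,b,e⟩ ≤ ⊕ᵢ ⟨dᵢ⟩` and `dᵢ² ≤ D/t`. The block inequality gives
`(abe)^{w/3} ≤ Σ dᵢ^w = Σ dᵢ²·(dᵢ²)^η ≤ D·(D/t)^η = D^{w/2}·t^{−η}`, while the packing gives
`c^{w/3}·D^{w/2} = (c·D^{3/2})^{w/3} ≤ (abe)^{w/3}`. Cancelling `D^{w/2} > 0`:
`c^{w/3} ≤ t^{−η}`, contradicting the choice of `t`. Hence `ω(ℂ) ≤ 2`, so `ω(ℂ) = 2`, which is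
`MatrixMultiplication` (`MatrixMultiplication_iff`).

References: H. Cohn, C. Umans, *A group-theoretic approach to fast matrix multiplication*, FOCS
2003, Thm. 4.1; H. Cohn, R. Kleinberg, B. Szegedy, C. Umans, *Group-theoretic algorithms for matrix
multiplication*, FOCS 2005 (arXiv:math/0511460), Thm. 1.8; M. Bläser, *Fast Matrix Multiplication*,
Theory of Computing Graduate Surveys 5 (2013), §5.
-/

-- single-conjunct summit: the mandated namespace `Summit.MatrixMultiplication.MatrixMultiplication.…`
-- repeats `MatrixMultiplication` (summit = sub-problem), which `linter.dupNamespace` would flag.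
set_option linter.dupNamespace false

namespace Summit.MatrixMultiplication.MatrixMultiplication.Theorems

open Summit.MatrixMultiplication.MatrixMultiplication.Theses.ReesMunnRealization
open Literature.Computability.AlgebraicComplexity
open Filter Topology

/-- **The loss/comparability trade-off behind route ReesMunnRealization** (pure real analysis).
If positive block sizes `dᵢ` with `D = Σᵢ dᵢ²` satisfy the packing `c·D^{3/2} ≤ A`, the block
inequality `A^{w/3} ≤ Σᵢ dᵢ^w` at an exponent `w > 2`, and the comparability `t·dᵢ² ≤ D` for all
`i` (`t > 0`), then the loss is forced down to `c^{w/3} ≤ t^{−(w−2)/2}`. Indeed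
`Σ dᵢ^w = Σ dᵢ²·(dᵢ²)^{(w−2)/2} ≤ D·(D/t)^{(w−2)/2} = D^{w/2}·t^{−(w−2)/2}` and
`(c·D^{3/2})^{w/3} = c^{w/3}·D^{w/2}`; cancel `D^{w/2} > 0`. [folklore] -/
theorem reesMunn_loss_rpow_le_of_blockBound {p : ℕ} (d : Fin p → ℝ) {c w t A D : ℝ}
    (hc : 0 < c) (hw : 2 < w) (ht : 0 < t) (hd : ∀ i, 0 < d i)
    (hD : ∑ i, d i ^ 2 = D) (hDpos : 0 < D)
    (hpack : c * D ^ ((3 : ℝ) / 2) ≤ A)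
    (hbound : A ^ (w / 3) ≤ ∑ i, d i ^ w)
    (hsmall : ∀ i, t * d i ^ 2 ≤ D) :
    c ^ (w / 3) ≤ t ^ (-((w - 2) / 2)) := by
  have hη : 0 < (w - 2) / 2 := by linarith
  -- every block is small: `dᵢ² ≤ D / t`
  have hdi : ∀ i, d i ^ 2 ≤ D / t := fun i => by
    rw [le_div_iff₀ ht]
    linarith [hsmall i]
  -- upper bound `Σ dᵢ^w ≤ D · (D/t)^η`
  have hup : ∑ i, d i ^ w ≤ D * (D / t) ^ ((w - 2) / 2) := by
    have key : ∀ i, d i ^ w ≤ d i ^ 2 * (D / t) ^ ((w - 2) / 2) := by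
      intro i
      have hsplit : d i ^ w = d i ^ 2 * (d i ^ 2) ^ ((w - 2) / 2) := by
        rw [← Real.rpow_two, ← Real.rpow_mul (hd i).le, ← Real.rpow_add (hd i)]
        congr 1
        ring
      rw [hsplit]
      exact mul_le_mul_of_nonneg_left (Real.rpow_le_rpow (sq_nonneg _) (hdi i) hη.le)
        (sq_nonneg _)
    calc ∑ i, d i ^ w ≤ ∑ i, d i ^ 2 * (D / t) ^ ((w - 2) / 2) :=
          Finset.sum_le_sum fun i _ => key i
      _ = D * (D / t) ^ ((w - 2) / 2) := by rw [← Finset.sum_mul, hD]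
  -- lower bound `c^{w/3} · D^{w/2} ≤ A^{w/3}`
  have hlow : c ^ (w / 3) * D ^ (w / 2) ≤ A ^ (w / 3) := by
    have h0 : 0 ≤ c * D ^ ((3 : ℝ) / 2) := mul_nonneg hc.le (Real.rpow_nonneg hDpos.le _)
    have h1 : (c * D ^ ((3 : ℝ) / 2)) ^ (w / 3) ≤ A ^ (w / 3) :=
      Real.rpow_le_rpow h0 hpack (by linarith)
    have h2 : (c * D ^ ((3 : ℝ) / 2)) ^ (w / 3) = c ^ (w / 3) * D ^ (w / 2) := by
      rw [Real.mul_rpow hc.le (Real.rpow_nonneg hDpos.le _), ← Real.rpow_mul hDpos.le,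
        show (3 : ℝ) / 2 * (w / 3) = w / 2 by ring]
    rw [← h2]
    exact h1
  -- bookkeeping: `D · (D/t)^η = D^{w/2} · t^{-η}`
  have h4 : D ^ (w / 2) = D * D ^ ((w - 2) / 2) := by
    rw [show w / 2 = 1 + (w - 2) / 2 by ring, Real.rpow_add hDpos, Real.rpow_one]
  have h3 : D * (D / t) ^ ((w - 2) / 2) = D ^ (w / 2) * t ^ (-((w - 2) / 2)) := by
    rw [Real.div_rpow hDpos.le ht.le, Real.rpow_neg ht.le, h4]
    ring
  have hcomb : c ^ (w / 3) * D ^ (w / 2) ≤ D ^ (w / 2) * t ^ (-((w - 2) / 2)) := by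
    rw [← h3]
    exact hlow.trans (hbound.trans hup)
  -- cancel `D^{w/2} > 0`
  have hDw : 0 < D ^ (w / 2) := Real.rpow_pos_of_pos hDpos _
  rw [mul_comm (D ^ (w / 2))] at hcomb
  exact le_of_mul_le_mul_right hcomb hDw

/-- **Assembly of route ReesMunnRealization** (item stmt-MatrixMultiplication-4378, exact route
signature `Summit.MatrixMultiplication.MatrixMultiplication.Theses.ReesMunnRealization.Assembly`):
`BlockRestrictionBound → BlockRestrictionFamily → MatrixMultiplication`. If `2 < w := ω(ℂ)`, pick
`t ≥ 1` with `t^{−(w−2)/2} < c^{w/3}` (`tendsto_rpow_neg_atTop`); the family's host at parameter `t`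
and the block inequality `BlockRestrictionBound` give, by `reesMunn_loss_rpow_le_of_blockBound`,
`c^{w/3} ≤ t^{−(w−2)/2}` — absurd. So `ω(ℂ) ≤ 2`; with `omega_two_le` this is `ω(ℂ) = 2`, i.e.
`MatrixMultiplication` (`MatrixMultiplication_iff`). Verbatim the type of the route's deciding
theorem `Theses.ReesMunnRealization.closes`; proved here without invoking it.
[cite: CohnUmans2003, Thm. 4.1] [cite: CohnKleinbergSzegedyUmans2005, Thm. 1.8]
[cite: Blaser2013, §5] -/
theorem reesMunnRealization_assembly_proof :
    Summit.MatrixMultiplication.MatrixMultiplication.Theses.ReesMunnRealization.Assembly := by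
  unfold Summit.MatrixMultiplication.MatrixMultiplication.Theses.ReesMunnRealization.Assembly
  intro hB hX
  rw [_root_.MatrixMultiplication_iff]
  refine le_antisymm (le_of_not_gt fun hgt => ?_) (omega_two_le ℂ)
  obtain ⟨c, hc, hfam⟩ := hX
  have hη : 0 < (omega ℂ - 2) / 2 := by linarith
  have hcw : 0 < c ^ (omega ℂ / 3) := Real.rpow_pos_of_pos hc _
  -- choose `t ≥ 1` with `t^{-η} < c^{ω/3}`
  have hlim : Tendsto (fun t : ℕ => (t : ℝ) ^ (-((omega ℂ - 2) / 2))) atTop (𝓝 0) :=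
    (tendsto_rpow_neg_atTop hη).comp tendsto_natCast_atTop_atTop
  obtain ⟨t, ht, ht1⟩ := ((hlim.eventually_lt_const hcw).and (eventually_ge_atTop 1)).exists
  have ht0 : (0 : ℝ) < t := Nat.cast_pos.mpr (Nat.lt_of_lt_of_le Nat.zero_lt_one ht1)
  -- the host at parameter `t`
  obtain ⟨p, d, a, b, e, hp, hd, -, hres, hpack, hsmall⟩ := hfam t
  have hbound := hB p d a b e hd hres
  have hdpos : ∀ i, (0 : ℝ) < d i := fun i =>
    Nat.cast_pos.mpr (Nat.lt_of_lt_of_le Nat.zero_lt_one (hd i))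
  -- `D = Σ dᵢ² > 0` since `p ≥ 1` and `d₀ ≥ 1`
  have hDpos : (0 : ℝ) < ∑ i, (d i : ℝ) ^ 2 :=
    lt_of_lt_of_le (pow_pos (hdpos ⟨0, hp⟩) 2)
      (Finset.single_le_sum (f := fun i => (d i : ℝ) ^ 2) (fun i _ => sq_nonneg _)
        (Finset.mem_univ _))
  have key := reesMunn_loss_rpow_le_of_blockBound (fun i => (d i : ℝ)) hc hgt ht0 hdpos rfl hDpos
    hpack hbound hsmall
  exact absurd ht (not_lt.2 key)

end Summit.MatrixMultiplication.MatrixMultiplication.Theorems
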